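import Summits.BirchSwinnertonDyer.BirchSwinnertonDyer.Theses.ClassRecordThree
import Summits.BirchSwinnertonDyer.BirchSwinnertonDyer.Theses.KolyvaginRoadThree
import Summits.BirchSwinnertonDyer.Rank1Residual.X11b.Three.HsiehDescentOfRangeReciprocity
import Literature.NumberTheory.EllipticCurves.CyclotomicZpExtension
import Literature.NumberTheory.PAdicHodge.TateSenCharacterInvariants
import HarnessLib

/-!
# Route `ClassRecordThree`, crux `HsiehDescentAtThree` (item stmt-BirchSwinnertonDyer-19108) — the Tate–Sen input in
# INERTIA form: the twist exponent dies on inertia given twist relations on the inertia group ONLY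

Cell `bsd-stepL` (run/shared/lean/pub/bsd-stepL/), seat `bsd-stepL-desc3-p1` (prover g2), `--supports
stmt-BirchSwinnertonDyer-19108` (crux 4 of `route-BirchSwinnertonDyer-ClassRecordThree`, shared with
`route-BirchSwinnertonDyer-KolyvaginRoadThree`; children 19238 `TateSenVanishingAtThree` ∕ 19281
`OpenValueReciprocityAtThree` ∕ glue 19240). Companion of bdp g9's `ClassRecordThreeHsiehDescentTateSen` (p415497), whose
two theorems are stated on the OPEN subgroup `G_F = {τ | τ fixes μ_m}`; here every quantifier is restricted further,
to the INERTIA group `I = {τ | τ fixes every root of unity of order prime to p} ⊆ G_F`, and the printed input is the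
same theorem of Tate–Sen for the p-adic field `K = 𝐐̂_p^un` (Brinon–Conrad Def. 1.3.1 / Thm. 2.2.7 / Ex. 1.4.4 (3);
named fact `Literature.NumberTheory.PAdicHodge.TateSenInertiaVanishing p`, tree file
`Literature/NumberTheory/PAdicHodge/TateSenCharacterInvariants.lean`). WHY: the descent node `Three.HsiehDescentAt₃ W`
IMPLIES exactness of the interpolated values for INERTIAL `τ` only (x11b3-p3's S30-e,
`X11b/Three/LocalExactnessOfDescent.lean`), so a sufficiency statement on `I` (sequel file
`ClassRecordThreeHsiehDescentOfInertialReciprocity`) makes the archimedean child of the crux necessary AND sufficient.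

## What this file proves

* `tateSenCharacterVanishing_of_inertia` — the inertia form implies bdp g9's `G_{ℚ_p(μ_m)}` form
  (`TateSenCharacterVanishing p`) by restriction; hence item 19238 `TateSenVanishingAtThree` from the inertia fact
  (`tateSenVanishingAtThree_of_tateSenInertia`, both route copies).
* `tateSenShape_of_tateSenInertia` — K3's semi-invariant SHAPE on `I` from the inertia fact (twin of
  `tateSenShape_of_tateSenCharacterVanishing`, proof verbatim with `G_F ↦ I`).
* `twistExponent_eq_zero_on_inertia_of_tateSenInertia` — if `E ≠ 0` in `𝓞_{ℂ_p}⟦T⟧` carries twist relations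
  `T_τ Ē = d(τ)·B_{a(τ)}·Ē` for all INERTIAL `τ`, then `a = 0` on inertia (twin of
  `twistExponent_eq_zero_on_inertia_of_tateSenCharacter`).

HONEST FRAMING: CONDITIONAL reductions; `TateSenInertiaVanishing p` is a hypothesis wherever used (a printed theorem,
NOT proved here: its proof runs Tate's normalised traces in a non-cyclotomic `ℤ_p`-tower over `𝐐̂_p^un`, beyond the
tree's cyclotomic `TateTwistInvariants` and beyond x11b3's unconditional `PadicSemiInvariant` — a character of `I` need
not extend to `Gal(ℚ̄_p/ℚ_p)`). Nothing of K5-B; no node, no item, no census word changes (T7).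

References: [BrinonConrad2009] Def. 1.3.1, Thm. 2.2.7 = Thm. 14.3.4, Exercise 1.4.4 (3), proof of Prop. 9.1.6 (p. 131);
[Tate1967] §3.3 Thm. 2; [Serre1973] Ch. II §3.2; [Washington1997] §5.1; tree `X11b/PadicSemiInvariant.lean` (K3),
`X11b/Three/LocalExactnessOfDescent.lean` (S30-e), `Theorems/ClassRecordThreeHsiehDescentTateSen.lean` (p415497).
-/

noncomputable section

set_option linter.dupNamespace false

open scoped NumberField Topology
open Filter NumberField IsDedekindDomain Field PowerSeries WeierstrassCurve
open Literature.NumberTheory.GaloisRepresentations Literature.NumberTheory.EllipticCurves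
open Literature.NumberTheory.EllipticCurves.ModularForms
open Summit.BirchSwinnertonDyer.Rank1Residual Summit.BirchSwinnertonDyer.Rank1Residual.X11b
open Summit.BirchSwinnertonDyer.Rank1Residual.X11b.Three
open Summit.BirchSwinnertonDyer.Rank1Residual.X11b.LambdaSupply
open Summit.BirchSwinnertonDyer.Rank1Residual.X11b.Three.LambdaSupply
open Summit.BirchSwinnertonDyer.Rank1Residual.X11b.PadicComplexTransport (continuous_algEquiv
  mem_unrIntegers_of_forall_inertia_fixed_family mem_fracUnr_of_forall_inertia_fixed_family)
open Summit.BirchSwinnertonDyer.Rank1Residual.X11b.Three.RangeTransport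
open Literature.NumberTheory.PAdicHodge (TateSenCharacterVanishing TateSenInertiaVanishing)

namespace Summit.BirchSwinnertonDyer.BirchSwinnertonDyer.Theorems

/-! ### §0 The inertia form implies the `G_{ℚ_p(μ_m)}` form -/

/-- **The `G_{ℚ_p(μ_m)}`-form follows from the inertia form**: for `0 < m`, `p ∤ m`, every `τ` fixing all roots of
unity of order prime to `p` fixes `μ_m`, so `I ⊆ G_F` for `F = ℚ_p(μ_m)`; a character of `G_F` with infinite image on
`I` restricts to a character of `I` with infinite image, and a `G_F`-semi-invariant is an `I`-semi-invariant. Hence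
`TateSenInertiaVanishing p → TateSenCharacterVanishing p` (Brinon–Conrad Thm. 2.2.7 for `𝐐̂_p^un` implies it for
the finite unramified `ℚ_p(μ_m)`, `H⁰` half). [cite: BrinonConrad2009, Thm. 2.2.7] -/
theorem tateSenCharacterVanishing_of_inertia (p : ℕ) [Fact p.Prime] (h : TateSenInertiaVanishing p) :
    TateSenCharacterVanishing p := by
  intro m hm hpm T hT hTτ η hmul hcont hnorm hinf x hx
  -- inertia `⊆ G_F`
  have hIS : ∀ τ : PadicAlgCl p ≃ₐ[ℚ_[p]] PadicAlgCl p,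
      (∀ ζ : PadicAlgCl p, (∃ k : ℕ, 0 < k ∧ ¬ p ∣ k ∧ ζ ^ k = 1) → τ ζ = ζ) →
      ∀ ζ : PadicAlgCl p, ζ ^ m = 1 → τ ζ = ζ :=
    fun τ hτ ζ hζ ↦ hτ ζ ⟨m, hm, hpm, hζ⟩
  exact h T hT hTτ η (fun τ₁ τ₂ h₁ h₂ ↦ hmul τ₁ τ₂ (hIS τ₁ h₁) (hIS τ₂ h₂))
    (hcont.mono fun τ hτ ↦ hIS τ hτ) (fun τ hτ ↦ hnorm τ (hIS τ hτ)) hinf x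
    (fun τ hτ ↦ hx τ (hIS τ hτ))

/-! ### §1 The printed fact (inertia form) implies K3's semi-invariant SHAPE on the inertia group -/

section TateSenInertia

variable {p : ℕ} [Fact p.Prime]

open Literature.NumberTheory.EllipticCurves.PadicOneUnits in
/-- **K3's semi-invariant shape on the INERTIA group from the printed Tate–Sen theorem in inertia form.** For a
family `T τ` of continuous extensions and `a : Gal(ℚ̄_p/ℚ_p) → ℤ_p` additive and continuous ON THE INERTIA GROUP
`I = {τ | τ fixes every root of unity of order prime to p}`: if every rational base point `w` near `1` and every
continuous `ψ : ℤ_p → ℂ_pˣ` with `ψ(1) = w` admit `q ≠ 0` with `T τ q = ψ(a τ) q` for all `τ ∈ I`, then `a` vanishes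
on `I`. Twin of `tateSenShape_of_tateSenCharacterVanishing` (p415497) with `G_{ℚ_p(μ_m)}` replaced by `I`:
`w = 1 + p^{e+1}`, `ψ = (1 + p^{e+1})^{(·)}` (`PadicOneUnits.oneAddPow`, continuous and injective),
`η := (1 + p^{e+1})^{a(·)}` is a norm-one `ℤ_p`-valued character on `I`; if `a(τ₀) ≠ 0` for some `τ₀ ∈ I`
the values `η(τ₀^n)` are pairwise distinct, so `η` has infinite image and `TateSenInertiaVanishing p` kills the
period — contradiction. [cite: BrinonConrad2009, Thm. 2.2.7] [cite: Serre1973, Ch. II §3.2 Prop. 8] -/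
theorem tateSenShape_of_tateSenInertia (h : TateSenInertiaVanishing p)
    (T : (PadicAlgCl p ≃ₐ[ℚ_[p]] PadicAlgCl p) → ℂ_[p] →+* ℂ_[p])
    (hT : ∀ τ, Continuous (T τ)) (hTτ : ∀ τ (x : PadicAlgCl p), T τ x = τ x)
    (a : (PadicAlgCl p ≃ₐ[ℚ_[p]] PadicAlgCl p) → ℤ_[p])
    (hadd : ∀ τ₁ τ₂, (∀ ζ : PadicAlgCl p, (∃ k : ℕ, 0 < k ∧ ¬ p ∣ k ∧ ζ ^ k = 1) → τ₁ ζ = ζ) → (∀ ζ : PadicAlgCl p, (∃ k : ℕ, 0 < k ∧ ¬ p ∣ k ∧ ζ ^ k = 1) → τ₂ ζ = ζ) →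
      a (τ₁ * τ₂) = a τ₁ + a τ₂)
    (hcont : ContinuousOn a {τ | ∀ ζ : PadicAlgCl p, (∃ k : ℕ, 0 < k ∧ ¬ p ∣ k ∧ ζ ^ k = 1) → τ ζ = ζ})
    (hper : ∃ δ : ℝ, 0 < δ ∧ ∀ (w : ℚ_[p]) (ψ : Multiplicative ℤ_[p] →* ℂ_[p]ˣ), Continuous ψ →
        ((ψ (Multiplicative.ofAdd 1) : ℂ_[p]ˣ) : ℂ_[p]) = algebraMap ℚ_[p] ℂ_[p] w →
        ‖algebraMap ℚ_[p] ℂ_[p] w - 1‖ < δ →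
        ∃ q : ℂ_[p], q ≠ 0 ∧ ∀ τ, (∀ ζ : PadicAlgCl p, (∃ k : ℕ, 0 < k ∧ ¬ p ∣ k ∧ ζ ^ k = 1) → τ ζ = ζ) →
          T τ q = ((ψ (Multiplicative.ofAdd (a τ)) : ℂ_[p]ˣ) : ℂ_[p]) * q) :
    ∀ τ₀, (∀ ζ : PadicAlgCl p, (∃ k : ℕ, 0 < k ∧ ¬ p ∣ k ∧ ζ ^ k = 1) → τ₀ ζ = ζ) → a τ₀ = 0 := by
  intro τ₀ hτ₀
  obtain ⟨δ, hδ, hper⟩ := hper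
  by_contra ha0
  have hp : p.Prime := Fact.out
  -- the base point `w = 1 + p^{e+1}` with `‖w - 1‖ < δ`, `e ≥ 1`
  have hp1 : ((p : ℝ)⁻¹) < 1 := inv_lt_one_of_one_lt₀ (by exact_mod_cast hp.one_lt)
  have hp0 : 0 ≤ ((p : ℝ)⁻¹) := by positivity
  obtain ⟨n, hn⟩ := exists_pow_lt_of_lt_one hδ hp1
  set e : ℕ := max n 1 with he_def
  have he1 : 1 ≤ e := le_max_right _ _
  have he' : e + 3 ≤ p * (e + 1) := by
    have h2 : 2 ≤ p := hp.two_le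
    nlinarith
  have hlt : ((p : ℝ)⁻¹) ^ (e + 1) < δ :=
    lt_of_le_of_lt (pow_le_pow_of_le_one hp0 hp1.le (by omega)) hn
  set q : ℤ_[p] := (p : ℤ_[p]) ^ (e + 1) with hq
  set w : ℚ_[p] := ((1 + q : ℤ_[p]) : ℚ_[p]) with hw_def
  have hw : ‖algebraMap ℚ_[p] ℂ_[p] w - 1‖ < δ := by
    rw [norm_sub_rev, ← norm_neg, neg_sub, ← map_one (algebraMap ℚ_[p] ℂ_[p]), ← map_sub,
      norm_algebraMap', hw_def, PadicInt.coe_add, PadicInt.coe_one, add_sub_cancel_left,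
      PadicInt.padic_norm_e_of_padicInt, hq, norm_pow, PadicInt.norm_p]
    exact hlt
  -- the character `ψ = (1+q)^{(·)}` into `ℂ_pˣ`
  set g : Multiplicative ℤ_[p] →* ℂ_[p] :=
    (((algebraMap ℚ_[p] ℂ_[p]).toMonoidHom.comp PadicInt.Coe.ringHom.toMonoidHom).comp
      (oneAddPow p e).toMonoidHom) with hg
  have hg_apply : ∀ y : Multiplicative ℤ_[p],
      g y = algebraMap ℚ_[p] ℂ_[p] ((oneAddPow p e y.toAdd : ℤ_[p]) : ℚ_[p]) := fun y ↦ rfl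
  have hgc : Continuous g := by
    have : (g : Multiplicative ℤ_[p] → ℂ_[p]) =
        fun y ↦ algebraMap ℚ_[p] ℂ_[p] ((oneAddPow p e y.toAdd : ℤ_[p]) : ℚ_[p]) := funext hg_apply
    rw [this]
    exact (isometry_padicInt_padicComplex (p := p)).continuous.comp
      ((continuous_oneAddPow e).comp continuous_toAdd)
  set ψ : Multiplicative ℤ_[p] →* ℂ_[p]ˣ := g.toHomUnits with hψ
  have hψval : ∀ y, ((ψ y : ℂ_[p]ˣ) : ℂ_[p]) = g y := fun y ↦ rfl
  have hψc : Continuous ψ := by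
    refine Units.continuous_iff.2 ⟨?_, ?_⟩
    · have : (Units.val ∘ ⇑ψ) = ⇑g := funext fun y ↦ rfl
      rw [this]; exact hgc
    · have : (fun y : Multiplicative ℤ_[p] ↦ ((ψ y)⁻¹ : ℂ_[p]ˣ).val) = fun y ↦ g y⁻¹ := by
        funext y; rw [← map_inv]; rfl
      rw [this]
      exact hgc.comp continuous_inv
  have hψ1 : ((ψ (Multiplicative.ofAdd 1) : ℂ_[p]ˣ) : ℂ_[p]) = algebraMap ℚ_[p] ℂ_[p] w := by
    rw [hψval, hg_apply, toAdd_ofAdd, oneAddPow_one]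
  -- the period
  obtain ⟨x, hx0, hx⟩ := hper w ψ hψc hψ1 hw
  -- the `ℤ_p`-valued character `η = (1+q)^{a(·)}`
  set η : (PadicAlgCl p ≃ₐ[ℚ_[p]] PadicAlgCl p) → ℤ_[p] := fun τ ↦ oneAddPow p e (a τ) with hη
  have hηmul : ∀ τ₁ τ₂, (∀ ζ : PadicAlgCl p, (∃ k : ℕ, 0 < k ∧ ¬ p ∣ k ∧ ζ ^ k = 1) → τ₁ ζ = ζ) →
      (∀ ζ : PadicAlgCl p, (∃ k : ℕ, 0 < k ∧ ¬ p ∣ k ∧ ζ ^ k = 1) → τ₂ ζ = ζ) → η (τ₁ * τ₂) = η τ₁ * η τ₂ := by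
    intro τ₁ τ₂ h₁ h₂
    simp only [hη, hadd τ₁ τ₂ h₁ h₂, AddChar.map_add_eq_mul]
  have hηcont : ContinuousOn η {τ | ∀ ζ : PadicAlgCl p, (∃ k : ℕ, 0 < k ∧ ¬ p ∣ k ∧ ζ ^ k = 1) → τ ζ = ζ} :=
    (continuous_oneAddPow e).comp_continuousOn hcont
  have hηnorm : ∀ τ, (∀ ζ : PadicAlgCl p, (∃ k : ℕ, 0 < k ∧ ¬ p ∣ k ∧ ζ ^ k = 1) → τ ζ = ζ) → ‖η τ‖ = 1 :=
    fun τ _ ↦ norm_oneAddPow e (a τ)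
  -- additivity on powers of `τ₀`
  have hpowI : ∀ k : ℕ, ∀ ζ : PadicAlgCl p, (∃ k' : ℕ, 0 < k' ∧ ¬ p ∣ k' ∧ ζ ^ k' = 1) → (τ₀ ^ k) ζ = ζ := by
    intro k
    induction k with
    | zero => intro ζ _; rw [pow_zero]; rfl
    | succ k ih => intro ζ hζ; rw [pow_succ, AlgEquiv.mul_apply, hτ₀ ζ hζ, ih ζ hζ]
  have ha1 : a 1 = 0 := by
    have := hadd 1 1 (fun _ _ ↦ rfl) (fun _ _ ↦ rfl)
    rw [mul_one] at this
    -- `a 1 = a 1 + a 1`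
    have h2 : a 1 + a 1 = a 1 + 0 := by rw [add_zero]; exact this.symm
    exact add_left_cancel h2
  have hapow : ∀ k : ℕ, a (τ₀ ^ k) = (k : ℤ_[p]) * a τ₀ := by
    intro k
    induction k with
    | zero => rw [pow_zero, ha1, Nat.cast_zero, zero_mul]
    | succ k ih =>
      rw [pow_succ, hadd _ _ (hpowI k) hτ₀, ih, Nat.cast_succ]
      ring
  have hηinf : (η '' {τ | ∀ ζ : PadicAlgCl p, (∃ k : ℕ, 0 < k ∧ ¬ p ∣ k ∧ ζ ^ k = 1) → τ ζ = ζ}).Infinite := by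
    have hinj : Function.Injective fun k : ℕ ↦ η (τ₀ ^ k) := by
      intro k k' hkk'
      have h1 : (k : ℤ_[p]) * a τ₀ = (k' : ℤ_[p]) * a τ₀ := by
        have := oneAddPow_injective e he' (by simpa only [hη, hapow] using hkk')
        exact this
      have h2 : (k : ℤ_[p]) = (k' : ℤ_[p]) := mul_right_cancel₀ ha0 h1
      exact_mod_cast h2
    exact Set.infinite_of_injective_forall_mem hinj fun k ↦ ⟨τ₀ ^ k, hpowI k, rfl⟩
  -- the period is a semi-invariant for `η` on `G_F`
  have hx' : ∀ τ, (∀ ζ : PadicAlgCl p, (∃ k : ℕ, 0 < k ∧ ¬ p ∣ k ∧ ζ ^ k = 1) → τ ζ = ζ) →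
      T τ x = algebraMap ℚ_[p] ℂ_[p] ((η τ : ℤ_[p]) : ℚ_[p]) * x := by
    intro τ hτ
    rw [hx τ hτ, hψval, hg_apply, toAdd_ofAdd]
  exact hx0 (h T hT hTτ η hηmul hηcont hηnorm hηinf x hx')

/-- **The twist exponent vanishes on inertia, given twist relations on the INERTIA group only and the printed
Tate–Sen theorem in inertia form.** Let `E ≠ 0` in `𝓞_{ℂ_p}⟦T⟧` carry, for every inertial `τ` (continuous extensions
`T_τ`), a twist relation `T_τĒ = d(τ)·B_{a(τ)}·Ē` with `d(τ) ≠ 0`. Then `a` is additive and continuous ON `I`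
(`twist_mul` ∕ `twist_unique`; the two-coefficient formula), the periods of `twist_period` are semi-invariants on
`I` (`twist_divXPowOrder`), so `tateSenShape_of_tateSenInertia` forces `a(τ) = 0` for every inertial `τ`. Twin of
`twistExponent_eq_zero_on_inertia_of_tateSenCharacter` (p415497) with `G_{ℚ_p(μ_m)}` replaced by `I` — the
weakest group on which the descent has exactness (S30-e). [cite: BrinonConrad2009, Thm. 2.2.7]
[cite: Tate1967, §3.3 Theorem 2] [cite: Washington1997, §5.1] -/
theorem twistExponent_eq_zero_on_inertia_of_tateSenInertia (hTS : TateSenInertiaVanishing p)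
    (T : (PadicAlgCl p ≃ₐ[ℚ_[p]] PadicAlgCl p) → ℂ_[p] →+* ℂ_[p])
    (hT : ∀ τ, Continuous (T τ)) (hTτ : ∀ τ (x : PadicAlgCl p), T τ x = τ x)
    {E : PowerSeries 𝓞_ℂ_[p]} (hE : E ≠ 0) {a : (PadicAlgCl p ≃ₐ[ℚ_[p]] PadicAlgCl p) → ℤ_[p]}
    {d : (PadicAlgCl p ≃ₐ[ℚ_[p]] PadicAlgCl p) → ℂ_[p]} (hd : ∀ τ, d τ ≠ 0)
    (h : ∀ τ, (∀ ζ : PadicAlgCl p, (∃ k : ℕ, 0 < k ∧ ¬ p ∣ k ∧ ζ ^ k = 1) → τ ζ = ζ) → (E.map (PadicComplexInt p).subtype).map (T τ) =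
      C (d τ) * ((((binomialSeries ℤ_[p] (a τ)).map (R1.toCpInt p)) * E).map
        (PadicComplexInt p).subtype)) :
    ∀ τ, (∀ ζ : PadicAlgCl p, (∃ k : ℕ, 0 < k ∧ ¬ p ∣ k ∧ ζ ^ k = 1) → τ ζ = ζ) → a τ = 0 := by
  -- the inertia group `I` (a submonoid of `Gal(ℚ̄_p/ℚ_p)`)
  set P : (PadicAlgCl p ≃ₐ[ℚ_[p]] PadicAlgCl p) → Prop := fun τ ↦
    ∀ ζ : PadicAlgCl p, (∃ k : ℕ, 0 < k ∧ ¬ p ∣ k ∧ ζ ^ k = 1) → τ ζ = ζ with hPdef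
  have hP1 : P 1 := fun _ _ ↦ rfl
  have hPmul : ∀ τ₁ τ₂, P τ₁ → P τ₂ → P (τ₁ * τ₂) := fun τ₁ τ₂ h₁ h₂ ζ hζ ↦ by
    rw [AlgEquiv.mul_apply, h₂ ζ hζ, h₁ ζ hζ]
  change ∀ τ, P τ → _ at h
  -- `a` is additive on `P`
  have hmul : ∀ τ₁ τ₂, P τ₁ → P τ₂ → a (τ₁ * τ₂) = a τ₁ + a τ₂ := by
    intro τ₁ τ₂ h₁ h₂
    have h12 := twist_mul (hTτ τ₁) (h τ₁ h₁) (h τ₂ h₂)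
    have hT12 : T (τ₁ * τ₂) = (T τ₁).comp (T τ₂) :=
      extension_mul (hT τ₁) (hTτ τ₁) (hT τ₂) (hTτ τ₂) (hT _) (hTτ _)
    have h' : (E.map (PadicComplexInt p).subtype).map (T (τ₁ * τ₂)) =
        ((E.map (PadicComplexInt p).subtype).map (T τ₂)).map (T τ₁) := by
      rw [hT12, map_comp, RingHom.comp_apply]
    rw [h (τ₁ * τ₂) (hPmul _ _ h₁ h₂), h12] at h'
    exact (twist_unique hE (hd _) h').2
  -- `a` is continuous on `P`: a rational function of two orbits there
  have hcont : ContinuousOn a {τ | P τ} := by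
    set F := E.map (PadicComplexInt p).subtype with hF
    have hF0 : F ≠ 0 := fun h0 ↦ hE (map_subtype_eq_zero_iff.1 h0)
    set m := F.order.toNat with hm
    set e₀ := coeff m F with he₀
    set e₁ := coeff (m + 1) F with he₁
    have he : e₀ ≠ 0 := coeff_order hF0
    have hid : ∀ τ, P τ → T τ e₀ = d τ * e₀ ∧
        T τ e₁ = d τ * (e₁ + algebraMap ℚ_[p] ℂ_[p] ((a τ : ℤ_[p]) : ℚ_[p]) * e₀) := by
      intro τ hτ
      obtain ⟨h0, h1⟩ := coeff_order_binomialTwist_mul (a τ) F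
      have hτ' := h τ hτ
      rw [map_mul] at hτ'
      refine ⟨?_, ?_⟩
      · have := congrArg (coeff m) hτ'
        rwa [coeff_map, coeff_C_mul, h0] at this
      · have := congrArg (coeff (m + 1)) hτ'
        rwa [coeff_map, coeff_C_mul, h1] at this
    have hTe : ∀ τ, T τ e₀ ≠ 0 := fun τ h0 ↦ by
      have : ‖e₀‖ = 0 := by rw [← norm_extension (hT τ) (hTτ τ) e₀, h0, norm_zero]
      exact he (norm_eq_zero.1 this)
    have hformula : ∀ τ, P τ → algebraMap ℚ_[p] ℂ_[p] ((a τ : ℤ_[p]) : ℚ_[p]) =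
        (T τ e₁ * e₀ - T τ e₀ * e₁) / (T τ e₀ * e₀) := by
      intro τ hτ
      obtain ⟨h0, h1⟩ := hid τ hτ
      rw [eq_div_iff (mul_ne_zero (hTe τ) he), h1, h0]
      ring
    have hcontF : Continuous fun τ ↦ (T τ e₁ * e₀ - T τ e₀ * e₁) / (T τ e₀ * e₀) :=
      (((continuous_orbit T hT hTτ e₁).mul continuous_const).sub
        ((continuous_orbit T hT hTτ e₀).mul continuous_const)).div
        ((continuous_orbit T hT hTτ e₀).mul continuous_const) fun τ ↦ mul_ne_zero (hTe τ) he
    have hcont' : ContinuousOn (fun τ ↦ algebraMap ℚ_[p] ℂ_[p] ((a τ : ℤ_[p]) : ℚ_[p]))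
        {τ | P τ} :=
      hcontF.continuousOn.congr fun τ hτ ↦ hformula τ hτ
    exact (isometry_padicInt_padicComplex (p := p)).isEmbedding.continuousOn_iff.2 hcont'
  -- the periods, on `E₁ = E / T^{ord E}`
  set E₁ := E.divXPowOrder with hE₁
  have he0 : ((constantCoeff E₁ : 𝓞_ℂ_[p]) : ℂ_[p]) ≠ 0 := by
    intro h0
    have : constantCoeff E₁ = 0 := Subtype.ext h0
    exact hE (constantCoeff_divXPowOrder_eq_zero_iff.1 this)
  have h₁ : ∀ τ, P τ → (E₁.map (PadicComplexInt p).subtype).map (T τ) =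
      C (d τ) * ((((binomialSeries ℤ_[p] (a τ)).map (R1.toCpInt p)) * E₁).map
        (PadicComplexInt p).subtype) := fun τ hτ ↦ twist_divXPowOrder (h τ hτ)
  refine tateSenShape_of_tateSenInertia hTS T hT hTτ a hmul hcont
    ⟨‖((constantCoeff E₁ : 𝓞_ℂ_[p]) : ℂ_[p])‖, norm_pos_iff.2 he0, fun w ψ hψc hψ1 hw ↦ ?_⟩
  have hx1 : ‖algebraMap ℚ_[p] ℂ_[p] w - 1‖ < 1 :=
    hw.trans_le (R1.norm_coe_padicComplexInt_le_one p _)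
  obtain ⟨v, hv⟩ := intSeries_exists_hasValueAt E₁ hx1
  refine ⟨v / ((constantCoeff E₁ : 𝓞_ℂ_[p]) : ℂ_[p]), ?_, fun τ hτ ↦ ?_⟩
  · exact div_ne_zero (twist_period (hT 1) (hTτ 1) (hd 1) (h₁ 1 hP1) hw hψc hψ1 hv).1 he0
  · exact (twist_period (hT τ) (hTτ τ) (hd τ) (h₁ τ hτ) hw hψc hψ1 hv).2

/-- **Item `stmt-BirchSwinnertonDyer-19238` (`TateSenVanishingAtThree` := `TateSenCharacterVanishing 3`) from the
inertia form**: Brinon–Conrad Thm. 2.2.7 for `K = 𝐐̂₃^un` implies it for `K = ℚ₃(μ_m)` (restriction to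
`I ⊆ G_{ℚ₃(μ_m)}`). CONDITIONAL on the named fact `TateSenInertiaVanishing 3`; the support item stays cite-only.
[cite: BrinonConrad2009, Thm. 2.2.7] -/
theorem tateSenVanishingAtThree_of_tateSenInertia (h : TateSenInertiaVanishing 3) :
    Summit.BirchSwinnertonDyer.BirchSwinnertonDyer.Theses.ClassRecordThree.TateSenVanishingAtThree :=
  tateSenCharacterVanishing_of_inertia 3 h

/-- **The `KolyvaginRoadThree` copy of item 19238 from the inertia form** (same proposition; shared item).
[cite: BrinonConrad2009, Thm. 2.2.7] -/
theorem kolyvaginRoadThree_tateSenVanishingAtThree_of_tateSenInertia (h : TateSenInertiaVanishing 3) :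
    Summit.BirchSwinnertonDyer.BirchSwinnertonDyer.Theses.KolyvaginRoadThree.TateSenVanishingAtThree :=
  tateSenCharacterVanishing_of_inertia 3 h

end TateSenInertia

end Summit.BirchSwinnertonDyer.BirchSwinnertonDyer.Theorems

end
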